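import Summits.QuantumFields.YangMills.Theorems.SwapVirialDeficitBlowUpGnomonicStratumBFlat
import Summits.QuantumFields.YangMills.Theorems.SwapVirialDeficitBlowUpGnomonicAnisoCoercivity
import HarnessLib

/-!
# THE B-POINT FIBRE COERCIVITY, η-directions: at an END hub and a stratum-B point `η_B = ((0,u),0,0,0)` the directions `y ∈ ℝ³`, `z ∈ ℝ³`, followers are stiff,
# with coefficients `≍ |u|²`-weighted for `y₀` (free-hands support of ⟨stmt-QuantumFields-24197⟩ `SwapVirialDeficit.SwapGluedStiffness`; region (Rd) of LEAD g98 memo5 §2 —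
# «B-point coercivity floor», first half: the letter directions at a fixed end hub; the hub-polar direction `δ` and the axial `x₀` (seam) direction are the sequel)

Along the B-fibre ray `η_B + s·ξ_B(d)`, `ξ_B(d) = ((x₀′,0,0), y′, z′, η_F′)`, the three global minorants of ✓`…AnisoCoercivity` touch `F̂` at `s = 0` (✓`gnoDeficit_stratumB_eq_zero`) and are again
of the form `s²·h(s)`: hub floor ✓`leadersW_hubStiff_le` (its `x`-term carries `(2A₀A₁)² = 0` at an end hub, `re a = 0`; its `y`-term `A₁²·gnoWtr(s·y′)` and `z`-term survive),
follower floor, commutator floor ✓`gnoDeficit_one_ge_cross` with `η_x = (s x₀′, u)`, `η_y = s·y′`: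
* §1 `gnoWtr_smul_ray` (`gnoWtr(s·v) = s²·4(v₁²+v₂²)/(1+s²|v|²)`), `stratumB_ray_letters`;
* §2 `stratumB_hub_ray_minorant`, `stratumB_follower_ray_minorant`, `stratumB_cross_ray_minorant` (each `∀ s`, explicit `s²·h(s) ≤ F̂`);
* §3 ★★★ `fibre_raySecond_ge_stratumB_eta (ha) (hre : a.re = 0) (ε) (hz) (hε) (u₁ u₂ d)`:
  `(2/3)·[ ((‖a‖⁻¹‖im a‖)²·4(y₁′²+y₂′²) + 4|z′|²)/16200L⁶ + 2Σ_f|η_f′|²/(2304L⁶|Fol L|) + ((u₁y₂′ − u₂y₁′)² + (u₂y₀′)² + (u₁y₀′)²)/(450L⁶(1+|u|²)) ] ≤ (d²/ds²)F̂(η_B + s·ξ_B(d))|₀`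
  — `y_⊥′`, `z′`, followers stiff uniformly; `y₀′` stiff with coefficient `|u|²/(1+|u|²)` (degenerating on the crossing `Σ = {u = 0}`, as in memo5 §2 (Rd)); NO floor yet in `x₀′`
  (the seam `[C₀,C₁]` at a B point) nor in the hub-polar direction.

HONEST LABEL: composition of landed inequalities; the (TS) regions, ⟨24197⟩ ∕ ⟨24194⟩ ∕ ⟨24497⟩ OPEN; own crux ⟨22884⟩ OPEN (blocked-on ⟨19935⟩); the Yang–Mills mass gap is NOT
proved; no summit is proved by a line.  THEOREMS ONLY (0 `def`, 0 `sorry`), standard axioms.  Width seat ym-line-sfw-p2-w3 g66 (cell ym-idea-1, free hands),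
`--supports stmt-QuantumFields-24197`.  References: [cite: Luscher1983, §2]; [folklore].
-/

set_option autoImplicit false

noncomputable section

open MeasureTheory Quaternion
open scoped BigOperators Quaternion ContDiff
open Literature.MathematicalPhysics.QuantumFieldTheory hiding SU2
open Literature.MathematicalPhysics.QuantumLattice

namespace Summit.QuantumFields.YangMills.Theorems.SwapVirialDeficit.BlowUpRing

open Summit.QuantumFields.YangMills.Theorems.FemtoTransferGap
open Summit.QuantumFields.YangMills.Theorems.FemtoTransferGap.TT
open Summit.QuantumFields.YangMills.Theorems.VirialFluxGap.RingDeficit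
open Summit.QuantumFields.YangMills.Theorems.SwapVirialDeficit.SwapRing
open Summit.QuantumFields.YangMills.Theorems.SwapVirialDeficit.Gnomonic (normSq3 normSq3_nonneg normSq3_smul gnomonicW gnomonicW_nonneg_le contDiff_gnoDeficit)
open Summit.QuantumFields.YangMills.Theorems.QuantitativeLaplace (iteratedDeriv_two_ge_of_three_minorants iteratedDeriv_two_sq_mul contDiff_sq_mul)

variable {L : ℕ} [NeZero L]

/-! ## §1 Ray closed forms at a B point -/

omit [NeZero L] in
/-- `gnoWtr(s·v) = s²·(4(v₁²+v₂²)/(1+s²|v|²))`. [folklore] -/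
theorem gnoWtr_smul_ray (s : ℝ) (v : Fin 3 → ℝ) : gnoWtr (s • v) = s ^ 2 * (4 * (v 1 ^ 2 + v 2 ^ 2) / (1 + s ^ 2 * normSq3 v)) := by
  simp only [gnoWtr, normSq3, Fin.sum_univ_three, Pi.smul_apply, smul_eq_mul]
  have hd : 0 < 1 + ((s * v 0) ^ 2 + (s * v 1) ^ 2 + (s * v 2) ^ 2) := by positivity
  have hd' : 0 < 1 + s ^ 2 * (v 0 ^ 2 + v 1 ^ 2 + v 2 ^ 2) := by positivity
  field_simp

omit [NeZero L] in
/-- The letters of the B-ray point `η_B + s·ξ_B(d)`. [folklore] -/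
theorem stratumB_ray_letters (u₁ u₂ s : ℝ) (d : ℝ × (Fin 3 → ℝ) × (Fin 3 → ℝ) × (Fol L → Fin 3 → ℝ)) :
    (((((![0, u₁, u₂] : Fin 3 → ℝ), (0 : Fin 3 → ℝ)), ((0 : Fin 3 → ℝ), (0 : Fol L → Fin 3 → ℝ))) : GnoCoord L) +
        s • ((((![d.1, 0, 0] : Fin 3 → ℝ), d.2.1), (d.2.2.1, d.2.2.2)) : GnoCoord L)).1.1 = (![0, u₁, u₂] : Fin 3 → ℝ) + s • ![d.1, 0, 0] ∧
    (((((![0, u₁, u₂] : Fin 3 → ℝ), (0 : Fin 3 → ℝ)), ((0 : Fin 3 → ℝ), (0 : Fol L → Fin 3 → ℝ))) : GnoCoord L) +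
        s • ((((![d.1, 0, 0] : Fin 3 → ℝ), d.2.1), (d.2.2.1, d.2.2.2)) : GnoCoord L)).1.2 = s • d.2.1 ∧
    (((((![0, u₁, u₂] : Fin 3 → ℝ), (0 : Fin 3 → ℝ)), ((0 : Fin 3 → ℝ), (0 : Fol L → Fin 3 → ℝ))) : GnoCoord L) +
        s • ((((![d.1, 0, 0] : Fin 3 → ℝ), d.2.1), (d.2.2.1, d.2.2.2)) : GnoCoord L)).2.1 = s • d.2.2.1 ∧
    (((((![0, u₁, u₂] : Fin 3 → ℝ), (0 : Fin 3 → ℝ)), ((0 : Fin 3 → ℝ), (0 : Fol L → Fin 3 → ℝ))) : GnoCoord L) +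
        s • ((((![d.1, 0, 0] : Fin 3 → ℝ), d.2.1), (d.2.2.1, d.2.2.2)) : GnoCoord L)).2.2 = s • d.2.2.2 := by
  refine ⟨rfl, ?_, ?_, ?_⟩
  · show (0 : Fin 3 → ℝ) + s • d.2.1 = s • d.2.1; rw [zero_add]
  · show (0 : Fin 3 → ℝ) + s • d.2.2.1 = s • d.2.2.1; rw [zero_add]
  · show (0 : Fol L → Fin 3 → ℝ) + s • d.2.2.2 = s • d.2.2.2; rw [zero_add]

/-! ## §2 The three touching ray minorants at a B point -/

section Minorants

variable {a : ℍ} (ε : GnoSign L) (u₁ u₂ : ℝ) (d : ℝ × (Fin 3 → ℝ) × (Fin 3 → ℝ) × (Fol L → Fin 3 → ℝ))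

/-- ★ **Hub ray minorant at a B point** (end hub `re a = 0`: the `x`-term of ✓`leadersW_hubStiff_le` vanishes):
`s²·[(‖a‖⁻¹‖im a‖)²·4(y₁′²+y₂′²)/(1+s²|y′|²) + 4|z′|²/(1+s²|z′|²)]/16200L⁶ ≤ F̂(η_B + s·ξ_B(d))`. [cite: Luscher1983, §2] -/
theorem stratumB_hub_ray_minorant (ha : a ≠ 0) (hre : a.re = 0) (s : ℝ) :
    s ^ 2 * (((‖a‖⁻¹ * ‖a.im‖) ^ 2 * (4 * (d.2.1 1 ^ 2 + d.2.1 2 ^ 2) / (1 + s ^ 2 * normSq3 d.2.1)) +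
        4 * normSq3 d.2.2.1 / (1 + s ^ 2 * normSq3 d.2.2.1)) / (16200 * (L : ℝ) ^ 6)) ≤
      gnoDeficit (fun _ => false) (fun _ => 1) a ε
        (((((![0, u₁, u₂] : Fin 3 → ℝ), (0 : Fin 3 → ℝ)), ((0 : Fin 3 → ℝ), (0 : Fol L → Fin 3 → ℝ))) : GnoCoord L) +
          s • ((((![d.1, 0, 0] : Fin 3 → ℝ), d.2.1), (d.2.2.1, d.2.2.2)) : GnoCoord L)) := by
  have hL : (0 : ℝ) < L := by exact_mod_cast NeZero.pos L
  have h := leadersW_hubStiff_le (L := L) ha ε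
    (((((![0, u₁, u₂] : Fin 3 → ℝ), (0 : Fin 3 → ℝ)), ((0 : Fin 3 → ℝ), (0 : Fol L → Fin 3 → ℝ))) : GnoCoord L) +
      s • ((((![d.1, 0, 0] : Fin 3 → ℝ), d.2.1), (d.2.2.1, d.2.2.2)) : GnoCoord L))
  obtain ⟨e1, e2, e3, -⟩ := stratumB_ray_letters (L := L) u₁ u₂ s (d := d)
  rw [e1, e2, e3, gnoWtr_smul_ray, gnomonicW_smul_ray, hre] at h
  simp only [mul_zero, zero_mul, ne_eq, OfNat.ofNat_ne_zero, not_false_eq_true, zero_pow, zero_add] at h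
  unfold gnoDeficit
  have h16 : (0 : ℝ) < 16200 * (L : ℝ) ^ 6 := by positivity
  set Y : ℝ := 4 * (d.2.1 1 ^ 2 + d.2.1 2 ^ 2) / (1 + s ^ 2 * normSq3 d.2.1) with hY
  set Z : ℝ := 4 * normSq3 d.2.2.1 / (1 + s ^ 2 * normSq3 d.2.2.1) with hZ
  have key : s ^ 2 * (((‖a‖⁻¹ * ‖a.im‖) ^ 2 * Y + Z) / (16200 * (L : ℝ) ^ 6)) = ((‖a‖⁻¹ * ‖a.im‖) ^ 2 * (s ^ 2 * Y) + s ^ 2 * Z) / (16200 * (L : ℝ) ^ 6) := by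
    ring
  rw [key, div_le_iff₀ h16]
  have hx : 0 ≤ (2 * (‖a‖⁻¹ * (0 : ℝ)) * (‖a‖⁻¹ * ‖a.im‖)) ^ 2 * gnoWtr ((![0, u₁, u₂] : Fin 3 → ℝ) + s • ![d.1, 0, 0]) := by
    have := (gnoWtr_nonneg_le ((![0, u₁, u₂] : Fin 3 → ℝ) + s • ![d.1, 0, 0])).1; positivity
  linarith [h]

/-- ★ **Follower ray minorant at a B point**: `s²·Σ_f (2|η_f′|²/(1+s²|η_f′|²)) / (2304L⁶|Fol L|) ≤ F̂(η_B + s·ξ_B(d))`. [cite: Luscher1983, §2] -/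
theorem stratumB_follower_ray_minorant (a : ℍ) (hε : ε.2.2 = fun _ => true) (s : ℝ) :
    s ^ 2 * ((∑ f, 2 * normSq3 (d.2.2.2 f) / (1 + s ^ 2 * normSq3 (d.2.2.2 f))) / (2304 * (L : ℝ) ^ 6 * (Fintype.card (Fol L) : ℝ))) ≤
      gnoDeficit (fun _ => false) (fun _ => 1) a ε
        (((((![0, u₁, u₂] : Fin 3 → ℝ), (0 : Fin 3 → ℝ)), ((0 : Fin 3 → ℝ), (0 : Fol L → Fin 3 → ℝ))) : GnoCoord L) +
          s • ((((![d.1, 0, 0] : Fin 3 → ℝ), d.2.1), (d.2.2.1, d.2.2.2)) : GnoCoord L)) := by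
  have hL : (0 : ℝ) < L := by exact_mod_cast NeZero.pos L
  have hcard : 0 < (Fintype.card (Fol L) : ℝ) := by
    have h1 : 1 ≤ L := Nat.one_le_iff_ne_zero.2 (NeZero.ne L)
    have h4 : 1 ≤ L ^ 4 := Nat.one_le_pow _ _ h1
    have h : 0 < Fintype.card (Fol L) := by rw [card_fol]; omega
    exact_mod_cast h
  set q := blowUpPoint (L := L) 1 (gnomonicPoint a ε (((((![0, u₁, u₂] : Fin 3 → ℝ), (0 : Fin 3 → ℝ)), ((0 : Fin 3 → ℝ), (0 : Fol L → Fin 3 → ℝ))) : GnoCoord L) + s • ((((![d.1, 0, 0] : Fin 3 → ℝ), d.2.1), (d.2.2.1, d.2.2.2)) : GnoCoord L))) with hq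
  have h := sum_follower_frobNorm_sq_le_chartDeficit (L := L) q
  obtain ⟨-, -, -, e4⟩ := stratumB_ray_letters (L := L) u₁ u₂ s (d := d)
  have hf : ∀ f, q.2 f = quatToSU2 (gnoLetter true (s • d.2.2.2 f)) := by
    intro f
    rw [hq, gnoFollower_eq, hε, e4]
    rfl
  have hsum : ∑ f, s ^ 2 * (2 * normSq3 (d.2.2.2 f) / (1 + s ^ 2 * normSq3 (d.2.2.2 f))) ≤
      ∑ f : Fol L, frobNorm (((q.2 f : SU2) : Matrix (Fin 2) (Fin 2) ℂ) - 1) ^ 2 :=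
    Finset.sum_le_sum fun f _ => by rw [hf]; exact gnoFollower_floor_smul s (d.2.2.2 f)
  have hC : (0 : ℝ) < 2304 * (L : ℝ) ^ 6 * (Fintype.card (Fol L) : ℝ) := by positivity
  have key : s ^ 2 * ((∑ f, 2 * normSq3 (d.2.2.2 f) / (1 + s ^ 2 * normSq3 (d.2.2.2 f))) / (2304 * (L : ℝ) ^ 6 * (Fintype.card (Fol L) : ℝ))) =
      (∑ f, s ^ 2 * (2 * normSq3 (d.2.2.2 f) / (1 + s ^ 2 * normSq3 (d.2.2.2 f)))) / (2304 * (L : ℝ) ^ 6 * (Fintype.card (Fol L) : ℝ)) := by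
    rw [← Finset.mul_sum]; ring
  rw [key, div_le_iff₀ hC]
  unfold gnoDeficit
  rw [← hq]
  have h' := hsum.trans h
  linarith

/-- ★ **Commutator ray minorant at a B point** (✓`gnoDeficit_one_ge_cross` with `η_x = (s·x₀′, u)`, `η_y = s·y′`):
`s²·[(u₁y₂′ − u₂y₁′)² + (u₂y₀′ − s·x₀′y₂′)² + (s·x₀′y₁′ − u₁y₀′)²]/(450L⁶(1 + s²x₀′² + |u|²)(1 + s²|y′|²)) ≤ F̂(η_B + s·ξ_B(d))`. [cite: Luscher1983, §2] -/
theorem stratumB_cross_ray_minorant (a : ℍ) (s : ℝ) :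
    s ^ 2 * (((u₁ * d.2.1 2 - u₂ * d.2.1 1) ^ 2 + (u₂ * d.2.1 0 - s * d.1 * d.2.1 2) ^ 2 + (s * d.1 * d.2.1 1 - u₁ * d.2.1 0) ^ 2) /
        (450 * (L : ℝ) ^ 6 * ((1 + (s ^ 2 * d.1 ^ 2 + (u₁ ^ 2 + u₂ ^ 2))) * (1 + s ^ 2 * normSq3 d.2.1)))) ≤
      gnoDeficit (fun _ => false) (fun _ => 1) a ε
        (((((![0, u₁, u₂] : Fin 3 → ℝ), (0 : Fin 3 → ℝ)), ((0 : Fin 3 → ℝ), (0 : Fol L → Fin 3 → ℝ))) : GnoCoord L) +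
          s • ((((![d.1, 0, 0] : Fin 3 → ℝ), d.2.1), (d.2.2.1, d.2.2.2)) : GnoCoord L)) := by
  have hL : (0 : ℝ) < L := by exact_mod_cast NeZero.pos L
  have h := gnoDeficit_one_ge_cross (L := L) a ε (((((![0, u₁, u₂] : Fin 3 → ℝ), (0 : Fin 3 → ℝ)), ((0 : Fin 3 → ℝ), (0 : Fol L → Fin 3 → ℝ))) : GnoCoord L) + s • ((((![d.1, 0, 0] : Fin 3 → ℝ), d.2.1), (d.2.2.1, d.2.2.2)) : GnoCoord L))
  obtain ⟨e1, e2, -, -⟩ := stratumB_ray_letters (L := L) u₁ u₂ s (d := d)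
  rw [e1, e2] at h
  simp only [normSq3, Fin.sum_univ_three, Pi.add_apply, Pi.smul_apply, smul_eq_mul, Matrix.cons_val_zero, Matrix.cons_val_one, Matrix.cons_val_two,
    Matrix.head_cons, Matrix.tail_cons, mul_zero, add_zero, zero_add] at h
  refine le_trans (le_of_eq ?_) h
  have hz := normSq3_nonneg d.2.1
  rw [← mul_div_assoc, div_eq_div_iff (by positivity) (by positivity)]
  simp only [normSq3, Fin.sum_univ_three]
  ring

end Minorants

/-! ## §3 The B-point Hessian floor in the letter directions -/

/-- ★★★ **THE B-POINT FIBRE COERCIVITY, η-directions** (end hub `a ≠ 0`, `re a = 0`; signs `ε_z = +`, followers `+`; base letter `u = (u₁,u₂)`; direction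
`ξ_B(d) = ((x₀′,0,0), y′, z′, η_F′)`):
`(2/3)·[((‖a‖⁻¹‖im a‖)²·4(y₁′²+y₂′²) + 4|z′|²)/16200L⁶ + (Σ_f 2|η_f′|²)/(2304L⁶|Fol L|) + ((u₁y₂′−u₂y₁′)² + (u₂y₀′)² + (u₁y₀′)²)/(450L⁶(1+|u|²))] ≤ (d²/ds²)F̂(η_B + s·ξ_B(d))|₀`.
[cite: Luscher1983, §2] -/
theorem fibre_raySecond_ge_stratumB_eta {a : ℍ} (ha : a ≠ 0) (hre : a.re = 0) (ε : GnoSign L) (hz : ε.2.1 = true) (hε : ε.2.2 = fun _ => true) (u₁ u₂ : ℝ)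
    (d : ℝ × (Fin 3 → ℝ) × (Fin 3 → ℝ) × (Fol L → Fin 3 → ℝ)) :
    2 / 3 * ((((‖a‖⁻¹ * ‖a.im‖) ^ 2 * (4 * (d.2.1 1 ^ 2 + d.2.1 2 ^ 2)) + 4 * normSq3 d.2.2.1) / (16200 * (L : ℝ) ^ 6)) +
        (∑ f, 2 * normSq3 (d.2.2.2 f)) / (2304 * (L : ℝ) ^ 6 * (Fintype.card (Fol L) : ℝ)) +
        ((u₁ * d.2.1 2 - u₂ * d.2.1 1) ^ 2 + (u₂ * d.2.1 0) ^ 2 + (u₁ * d.2.1 0) ^ 2) / (450 * (L : ℝ) ^ 6 * (1 + (u₁ ^ 2 + u₂ ^ 2)))) ≤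
      iteratedDeriv 2 (fun s : ℝ => gnoDeficit (fun _ => false) (fun _ => 1) a ε
        (((((![0, u₁, u₂] : Fin 3 → ℝ), (0 : Fin 3 → ℝ)), ((0 : Fin 3 → ℝ), (0 : Fol L → Fin 3 → ℝ))) : GnoCoord L) +
          s • ((((![d.1, 0, 0] : Fin 3 → ℝ), d.2.1), (d.2.2.1, d.2.2.2)) : GnoCoord L))) 0 := by
  have hL : (0 : ℝ) < L := by exact_mod_cast NeZero.pos L
  have hcard : 0 < (Fintype.card (Fol L) : ℝ) := by
    have h1 : 1 ≤ L := Nat.one_le_iff_ne_zero.2 (NeZero.ne L)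
    have h4 : 1 ≤ L ^ 4 := Nat.one_le_pow _ _ h1
    have h : 0 < Fintype.card (Fol L) := by rw [card_fol]; omega
    exact_mod_cast h
  -- the three `h` functions
  set h₁ : ℝ → ℝ := fun s => ((‖a‖⁻¹ * ‖a.im‖) ^ 2 * (4 * (d.2.1 1 ^ 2 + d.2.1 2 ^ 2) / (1 + s ^ 2 * normSq3 d.2.1)) +
      4 * normSq3 d.2.2.1 / (1 + s ^ 2 * normSq3 d.2.2.1)) / (16200 * (L : ℝ) ^ 6) with hh₁
  set h₂ : ℝ → ℝ := fun s => (∑ f, 2 * normSq3 (d.2.2.2 f) / (1 + s ^ 2 * normSq3 (d.2.2.2 f))) / (2304 * (L : ℝ) ^ 6 * (Fintype.card (Fol L) : ℝ)) with hh₂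
  set h₃ : ℝ → ℝ := fun s => ((u₁ * d.2.1 2 - u₂ * d.2.1 1) ^ 2 + (u₂ * d.2.1 0 - s * d.1 * d.2.1 2) ^ 2 + (s * d.1 * d.2.1 1 - u₁ * d.2.1 0) ^ 2) /
      (450 * (L : ℝ) ^ 6 * ((1 + (s ^ 2 * d.1 ^ 2 + (u₁ ^ 2 + u₂ ^ 2))) * (1 + s ^ 2 * normSq3 d.2.1))) with hh₃
  set φ : ℝ → ℝ := fun s : ℝ => gnoDeficit (fun _ => false) (fun _ => 1) a ε
      (((((![0, u₁, u₂] : Fin 3 → ℝ), (0 : Fin 3 → ℝ)), ((0 : Fin 3 → ℝ), (0 : Fol L → Fin 3 → ℝ))) : GnoCoord L) +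
        s • ((((![d.1, 0, 0] : Fin 3 → ℝ), d.2.1), (d.2.2.1, d.2.2.2)) : GnoCoord L)) with hφ
  -- smoothness
  have hy1 := normSq3_nonneg d.2.1
  have hz1 := normSq3_nonneg d.2.2.1
  have hq : ∀ (c e : ℝ), 0 < c → 0 ≤ e → ContDiff ℝ ∞ fun s : ℝ => c + s ^ 2 * e := by
    intro c e _ _
    exact contDiff_const.add ((contDiff_id.pow 2).mul contDiff_const)
  have hqne : ∀ (c e : ℝ), 0 < c → 0 ≤ e → ∀ s : ℝ, c + s ^ 2 * e ≠ 0 := by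
    intro c e hc he s
    positivity
  have hh₁d : ContDiff ℝ ∞ h₁ := by
    refine ContDiff.div_const ?_ _
    exact (contDiff_const.mul (contDiff_const.div (hq _ _ one_pos hy1) (hqne _ _ one_pos hy1))).add
      (contDiff_const.div (hq _ _ one_pos hz1) (hqne _ _ one_pos hz1))
  have hh₂d : ContDiff ℝ ∞ h₂ := by
    refine ContDiff.div_const ?_ _
    exact ContDiff.sum fun f _ => contDiff_const.div (hq _ _ one_pos (normSq3_nonneg _)) (hqne _ _ one_pos (normSq3_nonneg _))
  have hh₃d : ContDiff ℝ ∞ h₃ := by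
    have hnum : ContDiff ℝ ∞ fun s : ℝ => (u₁ * d.2.1 2 - u₂ * d.2.1 1) ^ 2 + (u₂ * d.2.1 0 - s * d.1 * d.2.1 2) ^ 2 +
        (s * d.1 * d.2.1 1 - u₁ * d.2.1 0) ^ 2 :=
      (contDiff_const.add ((contDiff_const.sub ((contDiff_id.mul contDiff_const).mul contDiff_const)).pow 2)).add
        ((((contDiff_id.mul contDiff_const).mul contDiff_const).sub contDiff_const).pow 2)
    have hden : ContDiff ℝ ∞ fun s : ℝ => 450 * (L : ℝ) ^ 6 * ((1 + (s ^ 2 * d.1 ^ 2 + (u₁ ^ 2 + u₂ ^ 2))) * (1 + s ^ 2 * normSq3 d.2.1)) :=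
      contDiff_const.mul ((contDiff_const.add (((contDiff_id.pow 2).mul contDiff_const).add contDiff_const)).mul (hq _ _ one_pos hy1))
    refine hnum.div hden fun s => ?_
    positivity
  have hφd : ContDiff ℝ ∞ φ := contDiff_gnoDeficit_ray (L := L) (fun _ => false) (fun _ => 1) ha ε _ _ (n := ⊤)
  -- touching at the B point
  have hφ0 : φ 0 = 0 := by
    simp only [hφ, zero_smul, add_zero]
    exact gnoDeficit_stratumB_eq_zero ha hre ε hz hε u₁ u₂
  -- the three minorants
  have key := iteratedDeriv_two_ge_of_three_minorants (φ := φ) (γ₁ := fun s => s ^ 2 * h₁ s) (γ₂ := fun s => s ^ 2 * h₂ s) (γ₃ := fun s => s ^ 2 * h₃ s)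
    hφd (contDiff_sq_mul hh₁d) (contDiff_sq_mul hh₂d) (contDiff_sq_mul hh₃d)
    (fun s => stratumB_hub_ray_minorant (L := L) ε u₁ u₂ (d := d) ha hre s) (fun s => stratumB_follower_ray_minorant (L := L) ε u₁ u₂ (d := d) a hε s)
    (fun s => stratumB_cross_ray_minorant (L := L) ε u₁ u₂ (d := d) a s) (by simp [hφ0]) (by simp [hφ0]) (by simp [hφ0])
  have h2 : (2 : WithTop ℕ∞) ≤ ∞ := by norm_cast
  rw [iteratedDeriv_two_sq_mul (hh₁d.of_le h2), iteratedDeriv_two_sq_mul (hh₂d.of_le h2), iteratedDeriv_two_sq_mul (hh₃d.of_le h2)] at key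
  -- evaluate the `h`'s at `0`
  have e1 : h₁ 0 = ((‖a‖⁻¹ * ‖a.im‖) ^ 2 * (4 * (d.2.1 1 ^ 2 + d.2.1 2 ^ 2)) + 4 * normSq3 d.2.2.1) / (16200 * (L : ℝ) ^ 6) := by
    simp [hh₁]
  have e2 : h₂ 0 = (∑ f, 2 * normSq3 (d.2.2.2 f)) / (2304 * (L : ℝ) ^ 6 * (Fintype.card (Fol L) : ℝ)) := by simp [hh₂]
  have e3 : h₃ 0 = ((u₁ * d.2.1 2 - u₂ * d.2.1 1) ^ 2 + (u₂ * d.2.1 0) ^ 2 + (u₁ * d.2.1 0) ^ 2) / (450 * (L : ℝ) ^ 6 * (1 + (u₁ ^ 2 + u₂ ^ 2))) := by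
    simp [hh₃]
  rw [e1, e2, e3] at key
  linarith

end Summit.QuantumFields.YangMills.Theorems.SwapVirialDeficit.BlowUpRing

end
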